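import Literature.NumberTheory.LFunctions.Zhang2022.DHMenuConsistentPrimesKit
import Literature.NumberTheory.LFunctions.RepulsiveLogFreeDensitySingleModulusProofs

/-!
# Zhang (2022), rung F-S3, family B-dh — calculus kit for the prime (A)-world, part 2: `θ_W` against the
# Thorner–Zaman main terms `h/φ(q)`, `λ·h/φ(q)` and the Corollary-5 main terms (typer-2's T2 / T3)

Y. Zhang, *Discrete mean estimates and the Landau–Siegel zero*, arXiv:2211.02515v1 [Zhang2022LandauSiegel] — an unrefereed
manuscript under adjudication. **The programme SEARCHES and TYPES; no claim about Landau–Siegel zeros, Theorems 1–2 of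
arXiv:2211.02515 or a repaired Margin232 until a kernel theorem says so.** Nothing here is a statement about primes or about a
Dirichlet `L`-function: `DH.primeWorld D χ` is explicit DATA and every theorem below is elementary calculus about it. Cell
`landau-siegel`, sub-cell E, row S-E-p4-6 — ls-barrier-plan g1 AMENDMENT OF RECORD 2026-08-26T21:53:22Z: «typer-2's T2
(`θ_W = lambdaExc·h/φ` when `x − h ≥ 1 ∧ D ∣ q`, `|diff| ≤ 2.1/φ` else) and T3 (relative error `≤ x^{−δ}/β₁ + 1/h`) INCLUDED
so typer-2 imports them» for the θ-rows P2–P5 of the §E target E-18b `DH.menuConsistentPrimes_holds`. Companion of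
`DHMenuConsistentPrimesKit` (p472204: closed forms, sign, monotonicity, rows S5.1–2 / P6); cites by name
`ThornerZaman2024PNTAP.lambdaExc_eq` / `corr_le` / `corr_nonneg` (p469308) and `primeWorld_theta_closed` /
`primeWorld_theta_self` / `primeWorld_theta_of_one_le_sub` (p472204) — nothing restated.

## Contents (`β₁ := betaExc D ∈ (½, 1)` at `log D ≥ 43 250`; `s := siegelSign D χ q a`, `|s| ≤ 1`; `φ := Nat.totient q`;
## `θ_W := (primeWorld D χ).theta`; `ψ` an induced slot `IsExcSlot D χ q ψ`, so `s = Re ψ(a)`)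

* §1 `integral_one_sub_mul_rpow'` (closed form for `−1 < r`, any endpoints), `one_div_betaExc_lt_two`,
  `siegelSign_of_isExcSlot` (`s(q,a) = Re ψ(a)` on the induced slot `ψ`).
* §2 (T2) `primeWorld_theta_eq_lambdaExc` — `θ_W(x;q,a,h) = λ(x,q,a,h)·h/φ(q)` EXACTLY for `x − h ≥ 1`, `h > 0`, `λ` =
  `ThornerZaman2024PNTAP.lambdaExc ψ β₁` (the printed main term of Theorem 1, exceptional case); `abs_primeWorld_theta_sub_lambdaExc_le`
  — `|θ_W − λ·h/φ| ≤ (1 + 1/β₁)/φ(q)` for `0 ≤ x − h`, `x ≥ 1`, `h > 0` (the cut-off below `t = 1` costs at most that).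
* §3 (T3) `primeWorld_theta_sub_main_eq` (the exact defect against `h/φ`), `abs_primeWorld_theta_sub_main_le` —
  `|θ_W − h/φ| ≤ (1 + h·x^{β₁−1}/β₁)/φ(q)` for `0 < h ≤ x`, `x ≥ 1`; the relative form `abs_primeWorld_theta_sub_main_le_rel` —
  `≤ (h/φ)·(x^{β₁−1}/β₁ + 1/h)`; the sharp short-interval form `abs_primeWorld_theta_sub_main_le_of_one_le_sub` —
  `≤ h·x^{β₁−1}/(β₁ φ)` for `x − h ≥ 1`.
* §4 (`h = x`, Corollary-5 shapes) `primeWorld_theta_self_sub_excMain` — `θ_W(x;q,a,x) − (1 − Re ψ(a)·x^{β₁−1}/β₁)·x/φ =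
  (Re ψ(a)/β₁ − 1)/φ` EXACTLY on the induced slot; `abs_primeWorld_theta_self_sub_excMain_le` (`≤ (1 + 1/β₁)/φ`);
  `abs_primeWorld_theta_self_sub_le_rel` (`|θ_W(x;q,a,x) − x/φ| ≤ (x/φ)·(x^{β₁−1}/β₁ + 1/x)`).

## References

* barrier/ASSIGNMENTS.md row S-E-p4-6; ls-barrier-plan g1 INBOX 21:28:23Z / 21:53:22Z; ls-Bdh-typer-2 g2 per-row map
  STATUS 21:37:42Z (T1–T3).
* [ThornerZaman2024PNTAP] Theorem 1 (1.4) p.3, Corollary 5 p.4; [Zhang2022LandauSiegel] §2 Assumption (A);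
  [MontgomeryVaughan2007] §9.1 (induced characters).
-/

noncomputable section

open scoped Classical
open Complex MeasureTheory

namespace Literature.NumberTheory.LFunctions.Zhang2022.DH

open ThornerZaman2024PNTAP

/-! ### 1. Closed form across `t = 0`, constants, the sign on an induced slot -/

/-- Closed form with ANY endpoints for `−1 < r`: `∫_u^v (1 − s·t^r) dt = (v − u) − s·(v^{r+1} − u^{r+1})/(r+1)` (the power is
locally integrable at `0`). [cite: ThornerZaman2024PNTAP, Theorem 1 (1.4) p.3] -/
theorem integral_one_sub_mul_rpow' (s : ℝ) {r : ℝ} (hr : -1 < r) (u v : ℝ) :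
    ∫ t in u..v, (1 - s * t ^ r) = (v - u) - s * ((v ^ (r + 1) - u ^ (r + 1)) / (r + 1)) := by
  have hI : IntervalIntegrable (fun t : ℝ => t ^ r) volume u v := intervalIntegral.intervalIntegrable_rpow' hr
  rw [intervalIntegral.integral_sub intervalIntegrable_const (hI.const_mul s), intervalIntegral.integral_const,
    intervalIntegral.integral_const_mul, smul_eq_mul, mul_one, integral_rpow (Or.inl hr)]

/-- `β₁(D) > 0` (`log D ≥ 43 250`); local copy of `DH.betaExc_pos` (DHMenuConsistentPrimesProof, p473947), kept private to
avoid importing the E-18b cone. [cite: BenliGoelTwissZaman2025, Corollary 1.1] -/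
private theorem betaExc_pos' {D : ℕ} (hL : (43250 : ℝ) ≤ Real.log D) : 0 < betaExc D := by
  linarith [half_lt_betaExc hL]

/-- `1/β₁(D) < 2` (`β₁ > ½`, `log D ≥ 43 250`). [cite: BenliGoelTwissZaman2025, Corollary 1.1] -/
theorem one_div_betaExc_lt_two {D : ℕ} (hL : (43250 : ℝ) ≤ Real.log D) : 1 / betaExc D < 2 := by
  have h := half_lt_betaExc hL
  rw [div_lt_iff₀ (betaExc_pos' hL)]
  linarith

section Induced

variable {D : ℕ} (χ : DirichletCharacter ℂ D)

/-- On an induced modulus the sign datum is the real part of the induced character: `D ∣ q ⇒ s(q,a) = Re (χ↑q)(a)`;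
local copy of `DH.siegelSign_of_dvd` (DHMenuConsistentPrimesProof, p473947). [cite: MontgomeryVaughan2007, §9.1] -/
private theorem siegelSign_of_dvd' {q : ℕ} (hq : D ∣ q) (a : ZMod q) :
    siegelSign D χ q a = ((DirichletCharacter.changeLevel hq χ) a).re := by
  unfold siegelSign
  rw [dif_pos hq]

/-- On the induced slot `ψ` (`IsExcSlot D χ q ψ`): `s(q,a) = Re ψ(a)`. [cite: MontgomeryVaughan2007, §9.1] -/
theorem siegelSign_of_isExcSlot {q : ℕ} {ψ : DirichletCharacter ℂ q} (hψ : IsExcSlot D χ q ψ) (a : ZMod q) :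
    siegelSign D χ q a = (ψ a).re := by
  obtain ⟨hq, rfl⟩ := hψ
  exact siegelSign_of_dvd' χ hq a

/-! ### 2. (T2) `θ_W` against the exceptional main term `λ·h/φ(q)` of Theorem 1 -/

/-- **T2, exact part.** On the induced slot `ψ`, for a unit `a`, `h > 0` and `x − h ≥ 1`:
`θ_W(x;q,a,h) = λ(x,q,a,h)·h/φ(q)` with `λ = ThornerZaman2024PNTAP.lambdaExc ψ β₁` — the printed main term of
Theorem 1 (exceptional case) EXACTLY. [cite: ThornerZaman2024PNTAP, Theorem 1 (1.4) p.3] -/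
theorem primeWorld_theta_eq_lambdaExc {q : ℕ} [NeZero q] {ψ : DirichletCharacter ℂ q} (hψ : IsExcSlot D χ q ψ)
    {a : ZMod q} (ha : IsUnit a) {x h : ℝ} (hh : 0 < h) (hxh : 1 ≤ x - h) :
    (primeWorld D χ).theta q a x h = lambdaExc ψ (betaExc D) a x h * h / Nat.totient q := by
  rw [primeWorld_theta_of_isUnit χ ha, max_eq_left hxh, max_eq_left (by linarith : (1 : ℝ) ≤ x),
    siegelSign_of_isExcSlot χ hψ]
  unfold lambdaExc
  rw [one_div, inv_mul_eq_div, div_mul_cancel₀ _ hh.ne']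

/-- **T2, defect part.** On the induced slot `ψ`, for a unit `a`, `h > 0`, `0 ≤ x − h` and `x ≥ 1`:
`|θ_W(x;q,a,h) − λ·h/φ(q)| ≤ (1 + 1/β₁)/φ(q)` — the two differ only by `∫_{x−h}^{1} (1 − s t^{β₁−1}) dt` when `x − h < 1`,
of size `≤ |x − h − 1| + |1 − (x−h)^{β₁}|/β₁ ≤ 1 + 1/β₁` (`log D ≥ 43 250`). [cite: ThornerZaman2024PNTAP, Theorem 1 (1.4) p.3] -/
theorem abs_primeWorld_theta_sub_lambdaExc_le (hL : (43250 : ℝ) ≤ Real.log D) {q : ℕ} [NeZero q]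
    {ψ : DirichletCharacter ℂ q} (hψ : IsExcSlot D χ q ψ) {a : ZMod q} (ha : IsUnit a) {x h : ℝ} (hh : 0 < h)
    (hxh : 0 ≤ x - h) (hx : 1 ≤ x) :
    |(primeWorld D χ).theta q a x h - lambdaExc ψ (betaExc D) a x h * h / Nat.totient q| ≤
      (1 + 1 / betaExc D) / Nat.totient q := by
  have hβ : 0 < betaExc D := betaExc_pos' hL
  have hφ : (0 : ℝ) < Nat.totient q := by exact_mod_cast Nat.totient_pos.mpr (NeZero.pos q)
  have hRHS : 0 ≤ (1 + 1 / betaExc D) / Nat.totient q := by positivity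
  by_cases h1 : 1 ≤ x - h
  · rw [primeWorld_theta_eq_lambdaExc χ hψ ha hh h1, sub_self, abs_zero]
    exact hRHS
  have h1 : x - h < 1 := lt_of_not_ge h1
  set β := betaExc D with hβdef
  set s := (ψ a).re with hsdef
  set u := x - h with hudef
  have hs : |s| ≤ 1 := by
    rw [hsdef, ← siegelSign_of_isExcSlot χ hψ a]; exact abs_siegelSign_le D χ q a
  -- `θ_W` in closed form on `[1, x]`
  have hθ : (primeWorld D χ).theta q a x h = ((x - 1) - s * ((x ^ β - 1) / β)) / Nat.totient q := by
    rw [primeWorld_theta_closed χ hL ha, max_eq_left hx, max_eq_right h1.le, Real.one_rpow,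
      siegelSign_of_isExcSlot χ hψ]
  -- `λ·h` in closed form on `[x − h, x]`
  have hΛ : lambdaExc ψ β a x h * h = h - s * ((x ^ β - u ^ β) / β) := by
    rw [lambdaExc_eq ψ hβ a x hh.ne']
    field_simp
    ring
  have hdiff : (primeWorld D χ).theta q a x h - lambdaExc ψ β a x h * h / Nat.totient q =
      ((u - 1) + s * ((1 - u ^ β) / β)) / Nat.totient q := by
    rw [hθ, hΛ, hudef]
    field_simp
    ring
  rw [hdiff, abs_div, abs_of_pos hφ]
  refine div_le_div_of_nonneg_right ?_ hφ.le
  have hu0 : 0 ≤ u := hxh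
  have huβ0 : 0 ≤ u ^ β := Real.rpow_nonneg hu0 β
  have huβ1 : u ^ β ≤ 1 := Real.rpow_le_one hu0 h1.le hβ.le
  have hA : |u - 1| ≤ 1 := abs_le.mpr ⟨by linarith, by linarith⟩
  have hB : |s * ((1 - u ^ β) / β)| ≤ 1 / β := by
    rw [abs_mul, abs_div, abs_of_pos hβ, abs_of_nonneg (by linarith : (0 : ℝ) ≤ 1 - u ^ β)]
    calc |s| * ((1 - u ^ β) / β) ≤ 1 * (1 / β) := by
          refine mul_le_mul hs (div_le_div_of_nonneg_right (by linarith) hβ.le) (by positivity) zero_le_one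
      _ = 1 / β := one_mul _
  calc |(u - 1) + s * ((1 - u ^ β) / β)| ≤ |u - 1| + |s * ((1 - u ^ β) / β)| := abs_add_le _ _
    _ ≤ 1 + 1 / β := add_le_add hA hB

/-! ### 3. (T3) `θ_W` against the regular main term `h/φ(q)` -/

/-- The exact defect against `h/φ(q)`: with `u := max(x−h, 1)`, for a unit `a` and `x ≥ 1`,
`θ_W(x;q,a,h) − h/φ(q) = ((x − u − h) − s·(x^{β₁} − u^{β₁})/β₁)/φ(q)` (`log D ≥ 43 250`).
[cite: ThornerZaman2024PNTAP, Theorem 1 (1.4) p.3] -/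
theorem primeWorld_theta_sub_main_eq (hL : (43250 : ℝ) ≤ Real.log D) {q : ℕ} [NeZero q] {a : ZMod q}
    (ha : IsUnit a) {x : ℝ} (hx : 1 ≤ x) (h : ℝ) :
    (primeWorld D χ).theta q a x h - h / Nat.totient q =
      ((x - max (x - h) 1 - h) -
          siegelSign D χ q a * ((x ^ betaExc D - max (x - h) 1 ^ betaExc D) / betaExc D)) / Nat.totient q := by
  have hφ : (Nat.totient q : ℝ) ≠ 0 := by exact_mod_cast (Nat.totient_pos.mpr (NeZero.pos q)).ne'
  rw [primeWorld_theta_closed χ hL ha, max_eq_left hx]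
  field_simp
  ring

/-- **T3.** For a unit `a`, `0 < h ≤ x`, `x ≥ 1`: `|θ_W(x;q,a,h) − h/φ(q)| ≤ (1 + h·x^{β₁−1}/β₁)/φ(q)` — the length defect
`|x − max(x−h,1) − h| ≤ 1` plus the Siegel correction `x^{β₁} − u^{β₁} ≤ (x − u)·x^{β₁−1} ≤ h·x^{β₁−1}` (chord bound
`ThornerZaman2024PNTAP.corr_le`; `log D ≥ 43 250`). [cite: ThornerZaman2024PNTAP, Theorem 1 (1.4) p.3] -/
theorem abs_primeWorld_theta_sub_main_le (hL : (43250 : ℝ) ≤ Real.log D) {q : ℕ} [NeZero q] {a : ZMod q}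
    (ha : IsUnit a) {x h : ℝ} (hh : 0 < h) (hhx : h ≤ x) (hx : 1 ≤ x) :
    |(primeWorld D χ).theta q a x h - h / Nat.totient q| ≤
      (1 + h * x ^ (betaExc D - 1) / betaExc D) / Nat.totient q := by
  have hβ : 0 < betaExc D := betaExc_pos' hL
  have hβ1 : betaExc D ≤ 1 := betaExc_le_one D
  have hφ : (0 : ℝ) < Nat.totient q := by exact_mod_cast Nat.totient_pos.mpr (NeZero.pos q)
  set β := betaExc D with hβdef
  set s := siegelSign D χ q a with hsdef
  set u := max (x - h) 1 with hudef
  have hs : |s| ≤ 1 := abs_siegelSign_le D χ q a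
  have hux : u ≤ x := max_le (by linarith) hx
  have hxu : x - u ≤ h := by have := le_max_left (x - h) 1; rw [← hudef] at this; linarith
  have hu1 : 1 ≤ u := le_max_right _ _
  have hx0 : 0 < x := by linarith
  have hxβ0 : 0 ≤ x ^ (β - 1) := Real.rpow_nonneg hx0.le _
  -- the Siegel correction: `0 ≤ x^β − u^β ≤ (x − u)·x^{β−1} ≤ h·x^{β−1}`
  have hcorr0 : 0 ≤ x ^ β - u ^ β := by
    have := corr_nonneg (β := β) (x := x) (h := x - u) hβ.le (by rw [sub_sub_cancel]; linarith)
      (by linarith)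
    rwa [sub_sub_cancel] at this
  have hcorr : x ^ β - u ^ β ≤ h * x ^ (β - 1) := by
    rcases eq_or_lt_of_le hux with hux' | hux'
    · rw [hux', sub_self]; positivity
    · have := corr_le (β := β) (x := x) (h := x - u) hβ hβ1 (by rw [sub_sub_cancel]; linarith) (by linarith)
      rw [sub_sub_cancel] at this
      exact this.trans (mul_le_mul_of_nonneg_right hxu hxβ0)
  rw [primeWorld_theta_sub_main_eq χ hL ha hx h, abs_div, abs_of_pos hφ]
  refine div_le_div_of_nonneg_right ?_ hφ.le
  have hA : |x - u - h| ≤ 1 := by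
    refine abs_le.mpr ⟨?_, by linarith⟩
    -- `x − u − h ≥ −1`: either `u = x − h` (then `= 0`) or `u = 1` (then `x − 1 − h ≥ −1` as `h ≤ x`)
    rcases le_total (x - h) 1 with hc | hc
    · rw [hudef, max_eq_right hc]; linarith
    · rw [hudef, max_eq_left hc]; linarith
  have hB : |s * ((x ^ β - u ^ β) / β)| ≤ h * x ^ (β - 1) / β := by
    rw [abs_mul, abs_div, abs_of_pos hβ, abs_of_nonneg hcorr0]
    calc |s| * ((x ^ β - u ^ β) / β) ≤ 1 * (h * x ^ (β - 1) / β) :=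
          mul_le_mul hs (div_le_div_of_nonneg_right hcorr hβ.le) (by positivity) zero_le_one
      _ = h * x ^ (β - 1) / β := one_mul _
  calc |x - u - h - s * ((x ^ β - u ^ β) / β)| ≤ |x - u - h| + |s * ((x ^ β - u ^ β) / β)| := abs_sub _ _
    _ ≤ 1 + h * x ^ (β - 1) / β := add_le_add hA hB

/-- **T3, relative form** (typer-2's «relative error `≤ x^{−δ}/β₁ + 1/h`»): for a unit `a`, `0 < h ≤ x`, `x ≥ 1`,
`|θ_W(x;q,a,h) − h/φ(q)| ≤ (h/φ(q))·(x^{β₁−1}/β₁ + 1/h)` (`log D ≥ 43 250`). [cite: ThornerZaman2024PNTAP, Theorem 1 (1.4) p.3] -/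
theorem abs_primeWorld_theta_sub_main_le_rel (hL : (43250 : ℝ) ≤ Real.log D) {q : ℕ} [NeZero q] {a : ZMod q}
    (ha : IsUnit a) {x h : ℝ} (hh : 0 < h) (hhx : h ≤ x) (hx : 1 ≤ x) :
    |(primeWorld D χ).theta q a x h - h / Nat.totient q| ≤
      h / Nat.totient q * (x ^ (betaExc D - 1) / betaExc D + 1 / h) := by
  have h1 := abs_primeWorld_theta_sub_main_le χ hL ha hh hhx hx
  have hφ : (Nat.totient q : ℝ) ≠ 0 := by exact_mod_cast (Nat.totient_pos.mpr (NeZero.pos q)).ne'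
  have heq : h / Nat.totient q * (x ^ (betaExc D - 1) / betaExc D + 1 / h) =
      (1 + h * x ^ (betaExc D - 1) / betaExc D) / Nat.totient q := by
    field_simp
    ring
  rw [heq]
  exact h1

/-- **T3, sharp short-interval form**: for a unit `a`, `h > 0`, `x − h ≥ 1`:
`|θ_W(x;q,a,h) − h/φ(q)| ≤ h·x^{β₁−1}/(β₁·φ(q))` (no length defect; `log D ≥ 43 250`). [cite: ThornerZaman2024PNTAP, Theorem 1 (1.4) p.3] -/
theorem abs_primeWorld_theta_sub_main_le_of_one_le_sub (hL : (43250 : ℝ) ≤ Real.log D) {q : ℕ} [NeZero q]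
    {a : ZMod q} (ha : IsUnit a) {x h : ℝ} (hh : 0 < h) (hxh : 1 ≤ x - h) :
    |(primeWorld D χ).theta q a x h - h / Nat.totient q| ≤
      h * x ^ (betaExc D - 1) / (betaExc D * Nat.totient q) := by
  have hβ : 0 < betaExc D := betaExc_pos' hL
  have hβ1 : betaExc D ≤ 1 := betaExc_le_one D
  have hφ : (0 : ℝ) < Nat.totient q := by exact_mod_cast Nat.totient_pos.mpr (NeZero.pos q)
  have hs : |siegelSign D χ q a| ≤ 1 := abs_siegelSign_le D χ q a
  have hcorr0 : 0 ≤ x ^ betaExc D - (x - h) ^ betaExc D := corr_nonneg hβ.le (by linarith) hh.le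
  have hcorr : x ^ betaExc D - (x - h) ^ betaExc D ≤ h * x ^ (betaExc D - 1) := corr_le hβ hβ1 (by linarith) hh
  have hdiff : (primeWorld D χ).theta q a x h - h / Nat.totient q =
      -(siegelSign D χ q a * ((x ^ betaExc D - (x - h) ^ betaExc D) / betaExc D)) / Nat.totient q := by
    rw [primeWorld_theta_of_one_le_sub χ hL ha hh.le hxh]
    ring
  rw [hdiff, abs_div, abs_of_pos hφ, abs_neg, abs_mul, abs_div, abs_of_pos hβ, abs_of_nonneg hcorr0,
    ← div_div]
  refine div_le_div_of_nonneg_right ?_ hφ.le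
  calc |siegelSign D χ q a| * ((x ^ betaExc D - (x - h) ^ betaExc D) / betaExc D)
      ≤ 1 * (h * x ^ (betaExc D - 1) / betaExc D) :=
        mul_le_mul hs (div_le_div_of_nonneg_right hcorr hβ.le) (by positivity) zero_le_one
    _ = h * x ^ (betaExc D - 1) / betaExc D := one_mul _

/-! ### 4. The diagonal `h = x` (Corollary 5 shapes) -/

/-- **Corollary-5 exceptional main term, EXACTLY.** On the induced slot `ψ`, for a unit `a` and `x ≥ 1`:
`θ_W(x;q,a,x) − (1 − Re ψ(a)·x^{β₁−1}/β₁)·x/φ(q) = (Re ψ(a)/β₁ − 1)/φ(q)` (`log D ≥ 43 250`).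
[cite: ThornerZaman2024PNTAP, Corollary 5 p.4] -/
theorem primeWorld_theta_self_sub_excMain (hL : (43250 : ℝ) ≤ Real.log D) {q : ℕ} [NeZero q]
    {ψ : DirichletCharacter ℂ q} (hψ : IsExcSlot D χ q ψ) {a : ZMod q} (ha : IsUnit a) {x : ℝ} (hx : 1 ≤ x) :
    (primeWorld D χ).theta q a x x - (1 - (ψ a).re * x ^ (betaExc D - 1) / betaExc D) * x / Nat.totient q =
      ((ψ a).re / betaExc D - 1) / Nat.totient q := by
  have hβ : betaExc D ≠ 0 := betaExc_ne_zero hL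
  have hx0 : x ≠ 0 := by positivity
  have hφ : (Nat.totient q : ℝ) ≠ 0 := by exact_mod_cast (Nat.totient_pos.mpr (NeZero.pos q)).ne'
  rw [primeWorld_theta_self χ hL ha hx, siegelSign_of_isExcSlot χ hψ, Real.rpow_sub_one hx0]
  field_simp
  ring

/-- `|θ_W(x;q,a,x) − (1 − Re ψ(a)·x^{β₁−1}/β₁)·x/φ(q)| ≤ (1 + 1/β₁)/φ(q)` on the induced slot, unit `a`, `x ≥ 1`
(`|Re ψ(a)| ≤ 1`; `log D ≥ 43 250`). [cite: ThornerZaman2024PNTAP, Corollary 5 p.4] -/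
theorem abs_primeWorld_theta_self_sub_excMain_le (hL : (43250 : ℝ) ≤ Real.log D) {q : ℕ} [NeZero q]
    {ψ : DirichletCharacter ℂ q} (hψ : IsExcSlot D χ q ψ) {a : ZMod q} (ha : IsUnit a) {x : ℝ} (hx : 1 ≤ x) :
    |(primeWorld D χ).theta q a x x - (1 - (ψ a).re * x ^ (betaExc D - 1) / betaExc D) * x / Nat.totient q| ≤
      (1 + 1 / betaExc D) / Nat.totient q := by
  have hβ : 0 < betaExc D := betaExc_pos' hL
  have hφ : (0 : ℝ) < Nat.totient q := by exact_mod_cast Nat.totient_pos.mpr (NeZero.pos q)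
  have hs : |(ψ a).re| ≤ 1 := by
    rw [← siegelSign_of_isExcSlot χ hψ a]; exact abs_siegelSign_le D χ q a
  rw [primeWorld_theta_self_sub_excMain χ hL hψ ha hx, abs_div, abs_of_pos hφ]
  refine div_le_div_of_nonneg_right ?_ hφ.le
  have h1 : |(ψ a).re / betaExc D| ≤ 1 / betaExc D := by
    rw [abs_div, abs_of_pos hβ]; exact div_le_div_of_nonneg_right hs hβ.le
  calc |(ψ a).re / betaExc D - 1| ≤ |(ψ a).re / betaExc D| + |(1 : ℝ)| := abs_sub _ _
    _ ≤ 1 / betaExc D + 1 := add_le_add h1 (by rw [abs_one])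
    _ = 1 + 1 / betaExc D := add_comm _ _

/-- **Corollary-5 regular main term, relative form**: for a unit `a` and `x ≥ 1`,
`|θ_W(x;q,a,x) − x/φ(q)| ≤ (x/φ(q))·(x^{β₁−1}/β₁ + 1/x)` (T3 at `h = x`; `log D ≥ 43 250`).
[cite: ThornerZaman2024PNTAP, Corollary 5 p.4] -/
theorem abs_primeWorld_theta_self_sub_le_rel (hL : (43250 : ℝ) ≤ Real.log D) {q : ℕ} [NeZero q] {a : ZMod q}
    (ha : IsUnit a) {x : ℝ} (hx : 1 ≤ x) :
    |(primeWorld D χ).theta q a x x - x / Nat.totient q| ≤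
      x / Nat.totient q * (x ^ (betaExc D - 1) / betaExc D + 1 / x) :=
  abs_primeWorld_theta_sub_main_le_rel χ hL ha (by linarith) le_rfl hx

end Induced

end Literature.NumberTheory.LFunctions.Zhang2022.DH

end
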